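import Summits.CriticalPhenomena.PercolationContinuityZ3.Theorems.PercNearOneGluingNoHeavyLowerTailSahiCombTriWAndOrCherryRows
import Summits.CriticalPhenomena.PercolationContinuityZ3.Theorems.PercNearOneGluingNoHeavyLowerTailSahiCombTriWAndOrCherryRecipesA
import Summits.CriticalPhenomena.PercolationContinuityZ3.Theorems.PercNearOneGluingNoHeavyLowerTailSahiCombTriWAndOrCherryRecipesB

/-!
# AND with the block `orCherry` ⊆ `2^(Fin 4)` = `x₀ ∨ x₁(x₂ ∨ x₃)`, part 3: `AndShellLower` for `Q = orCherry`

Support file of the one-cut programme (crux `NoHeavyLowerTail`, stmt-CriticalPhenomena-4575; unit `prim-lf-1` gen 47, memo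
`FROM-prim-lf-1-gen47-JOINT-RECIPES.md`).  The exact certificate `rowLow_orCherry_eq_cert` (18 K⊗K products, 48 N⊗N products, 2 rearrangement
slacks; integer coefficients after scaling by 2; an identity of canonical indicator polynomials, found by the FUNCTION-level certificate LP with
JOINT recipes, HOME/code/gen47/funcert) and the consequences **`lForm_le_scoreVal_andProd_orCherry`**, `scoreCert_andProd_orCherry`,
**`triW_nonneg_andProd_orCherry`** (TriWIneq for `P₁ ∧ orCherry` on every index cube, every intersecting Kleitman shell `P₁`), `…_of_klShell`.
HONEST LABEL: complete proofs, std axioms; `AndShellLower` for this block only. [this work]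
-/

namespace Summit.CriticalPhenomena.PercolationContinuityZ3.Theorems

namespace FiveUpSet

open Finset

variable {β γ₁ : Type} [DecidableEq β] [Fintype β] [DecidableEq γ₁] [Fintype γ₁]

/-! ### The certificate -/

/-- **The certificate identity** for one row of `P₁ ∧ orCherry` (canonical indicator polynomials; scale 2). [this work] -/
theorem rowLow_orCherry_eq_cert (A B : Finset (Finset (γ₁ ⊕ Fin 4))) (x : Finset γ₁) :
    2 * rowLow_orCherry A B x =
      2 * (rK1_orCherry A x * rK2_orCherry B x)
      + 2 * (rK2_orCherry A x * rK1_orCherry B x)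
      + 2 * (rK3_orCherry A x * rK3_orCherry B x)
      + (rK4_orCherry A x * rK5_orCherry B x)
      + (rK6_orCherry A x * rK7_orCherry B x)
      + (rK7_orCherry A x * rK6_orCherry B x)
      + (rK5_orCherry A x * rK4_orCherry B x)
      + (rK6_orCherry A x * rK8_orCherry B x)
      + (rK8_orCherry A x * rK6_orCherry B x)
      + (rK4_orCherry A x * rK9_orCherry B x)
      + (rK9_orCherry A x * rK4_orCherry B x)
      + (rK10_orCherry A x * rK10_orCherry B x)
      + (rK11_orCherry A x * rK11_orCherry B x)
      + (rK10_orCherry A x * rK12_orCherry B x)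
      + (rK12_orCherry A x * rK10_orCherry B x)
      + (rK12_orCherry A x * rK11_orCherry B x)
      + (rK11_orCherry A x * rK12_orCherry B x)
      + 2 * (rK13_orCherry A x * rK13_orCherry B x)
      + (rN1_orCherry A x * rN2_orCherry B x)
      + (rN3_orCherry A x * rN2_orCherry B x)
      + (rN2_orCherry A x * rN1_orCherry B x)
      + (rN2_orCherry A x * rN3_orCherry B x)
      + (rN4_orCherry A x * rN5_orCherry B x)
      + (rN5_orCherry A x * rN4_orCherry B x)
      + (rN5_orCherry A x * rN6_orCherry B x)
      + (rN6_orCherry A x * rN5_orCherry B x)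
      + 2 * (rN7_orCherry A x * rN8_orCherry B x)
      + 2 * (rN8_orCherry A x * rN7_orCherry B x)
      + (rN9_orCherry A x * rN10_orCherry B x)
      + (rN11_orCherry A x * rN12_orCherry B x)
      + (rN12_orCherry A x * rN11_orCherry B x)
      + (rN10_orCherry A x * rN9_orCherry B x)
      + (rN13_orCherry A x * rN14_orCherry B x)
      + (rN15_orCherry A x * rN14_orCherry B x)
      + (rN14_orCherry A x * rN13_orCherry B x)
      + (rN14_orCherry A x * rN15_orCherry B x)
      + (rN11_orCherry A x * rN11_orCherry B x)
      + (rN10_orCherry A x * rN10_orCherry B x)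
      + (rN1_orCherry A x * rN1_orCherry B x)
      + (rN3_orCherry A x * rN3_orCherry B x)
      + (rN16_orCherry A x * rN17_orCherry B x)
      + (rN17_orCherry A x * rN16_orCherry B x)
      + (rN18_orCherry A x * rN19_orCherry B x)
      + (rN19_orCherry A x * rN18_orCherry B x)
      + (rN18_orCherry A x * rN20_orCherry B x)
      + (rN21_orCherry A x * rN16_orCherry B x)
      + (rN16_orCherry A x * rN21_orCherry B x)
      + (rN20_orCherry A x * rN18_orCherry B x)
      + (rN22_orCherry A x * rN6_orCherry B x)
      + (rN6_orCherry A x * rN22_orCherry B x)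
      + (rN23_orCherry A x * rN4_orCherry B x)
      + (rN4_orCherry A x * rN23_orCherry B x)
      + (rN23_orCherry A x * rN24_orCherry B x)
      + (rN24_orCherry A x * rN22_orCherry B x)
      + (rN24_orCherry A x * rN23_orCherry B x)
      + (rN22_orCherry A x * rN24_orCherry B x)
      + (rN25_orCherry A x * rN17_orCherry B x)
      + (rN26_orCherry A x * rN19_orCherry B x)
      + (rN19_orCherry A x * rN26_orCherry B x)
      + (rN17_orCherry A x * rN25_orCherry B x)
      + (rN27_orCherry A x * rN20_orCherry B x)
      + (rN20_orCherry A x * rN27_orCherry B x)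
      + (rN28_orCherry A x * rN21_orCherry B x)
      + (rN21_orCherry A x * rN28_orCherry B x)
      + (rN26_orCherry A x * rN26_orCherry B x)
      + (rN25_orCherry A x * rN25_orCherry B x)
      + rs1_orCherry A B x
      + rs2_orCherry A B x := by
  unfold rowLow_orCherry rK10_orCherry rK11_orCherry rK12_orCherry rK13_orCherry rK1_orCherry rK2_orCherry rK3_orCherry rK4_orCherry rK5_orCherry rK6_orCherry rK7_orCherry rK8_orCherry rK9_orCherry rN10_orCherry rN11_orCherry rN12_orCherry rN13_orCherry rN14_orCherry rN15_orCherry rN16_orCherry rN17_orCherry rN18_orCherry rN19_orCherry rN1_orCherry rN20_orCherry rN21_orCherry rN22_orCherry rN23_orCherry rN24_orCherry rN25_orCherry rN26_orCherry rN27_orCherry rN28_orCherry rN2_orCherry rN3_orCherry rN4_orCherry rN5_orCherry rN6_orCherry rN7_orCherry rN8_orCherry rN9_orCherry rs1_orCherry rs2_orCherry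
  ring

/-! ### The theorem -/

section main
variable {P₁ : Finset (Finset γ₁)} (hP : IsUpperSet (P₁ : Set (Finset γ₁))) (hd : Disjoint P₁ (refl P₁))
  (hcor : ∀ U V : Finset (Finset γ₁), IsUpperSet (U : Set (Finset γ₁)) → IsUpperSet (V : Set (Finset γ₁)) → 0 ≤ corP P₁ U V)
include hP hd hcor

/-- **THEOREM (`AndShellLower` for `Q = orCherry`).**  For every antipode-free up-set `P₁` with `Cor_(P₁) ≥ 0` on up-set pairs and all up-sets
`A, B`: `L_(P₁ ∧ orCherry)(A,B) ≤ Σ_B secFAScore P₁ orCherry`. [this work] -/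
theorem lForm_le_scoreVal_andProd_orCherry {A B : Finset (Finset (γ₁ ⊕ Fin 4))} (hA : IsUpperSet (A : Set (Finset (γ₁ ⊕ Fin 4))))
    (hB : IsUpperSet (B : Set (Finset (γ₁ ⊕ Fin 4)))) :
    lForm (andProd P₁ orCherry) A B ≤ scoreVal (secFAScore P₁ orCherry) A B := by
  suffices h : 0 ≤ (2 : ℤ) * (scoreVal (secFAScore P₁ orCherry) A B - lForm (andProd P₁ orCherry) A B) by nlinarith
  rw [scoreVal_sub_lForm_andProd_orCherry, mul_sum, sum_congr rfl fun x _ => rowLow_orCherry_eq_cert A B x]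
  simp only [sum_add_distrib]
  have t1 : 0 ≤ ∑ x ∈ P₁, 2 * (rK1_orCherry A x * rK2_orCherry B x) := by rw [← Finset.mul_sum]; exact mul_nonneg (by norm_num) (IsUnitK.sum_mul_nonneg hP hd hcor (rK1_orCherry_isUnitK hA) (rK2_orCherry_isUnitK hB))
  have t2 : 0 ≤ ∑ x ∈ P₁, 2 * (rK2_orCherry A x * rK1_orCherry B x) := by rw [← Finset.mul_sum]; exact mul_nonneg (by norm_num) (IsUnitK.sum_mul_nonneg hP hd hcor (rK2_orCherry_isUnitK hA) (rK1_orCherry_isUnitK hB))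
  have t3 : 0 ≤ ∑ x ∈ P₁, 2 * (rK3_orCherry A x * rK3_orCherry B x) := by rw [← Finset.mul_sum]; exact mul_nonneg (by norm_num) (IsUnitK.sum_mul_nonneg hP hd hcor (rK3_orCherry_isUnitK hA) (rK3_orCherry_isUnitK hB))
  have t4 : 0 ≤ ∑ x ∈ P₁, (rK4_orCherry A x * rK5_orCherry B x) := IsUnitK.sum_mul_nonneg hP hd hcor (rK4_orCherry_isUnitK hA) (rK5_orCherry_isUnitK hB)
  have t5 : 0 ≤ ∑ x ∈ P₁, (rK6_orCherry A x * rK7_orCherry B x) := IsUnitK.sum_mul_nonneg hP hd hcor (rK6_orCherry_isUnitK hA) (rK7_orCherry_isUnitK hB)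
  have t6 : 0 ≤ ∑ x ∈ P₁, (rK7_orCherry A x * rK6_orCherry B x) := IsUnitK.sum_mul_nonneg hP hd hcor (rK7_orCherry_isUnitK hA) (rK6_orCherry_isUnitK hB)
  have t7 : 0 ≤ ∑ x ∈ P₁, (rK5_orCherry A x * rK4_orCherry B x) := IsUnitK.sum_mul_nonneg hP hd hcor (rK5_orCherry_isUnitK hA) (rK4_orCherry_isUnitK hB)
  have t8 : 0 ≤ ∑ x ∈ P₁, (rK6_orCherry A x * rK8_orCherry B x) := IsUnitK.sum_mul_nonneg hP hd hcor (rK6_orCherry_isUnitK hA) (rK8_orCherry_isUnitK hB)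
  have t9 : 0 ≤ ∑ x ∈ P₁, (rK8_orCherry A x * rK6_orCherry B x) := IsUnitK.sum_mul_nonneg hP hd hcor (rK8_orCherry_isUnitK hA) (rK6_orCherry_isUnitK hB)
  have t10 : 0 ≤ ∑ x ∈ P₁, (rK4_orCherry A x * rK9_orCherry B x) := IsUnitK.sum_mul_nonneg hP hd hcor (rK4_orCherry_isUnitK hA) (rK9_orCherry_isUnitK hB)
  have t11 : 0 ≤ ∑ x ∈ P₁, (rK9_orCherry A x * rK4_orCherry B x) := IsUnitK.sum_mul_nonneg hP hd hcor (rK9_orCherry_isUnitK hA) (rK4_orCherry_isUnitK hB)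
  have t12 : 0 ≤ ∑ x ∈ P₁, (rK10_orCherry A x * rK10_orCherry B x) := IsUnitK.sum_mul_nonneg hP hd hcor (rK10_orCherry_isUnitK hA) (rK10_orCherry_isUnitK hB)
  have t13 : 0 ≤ ∑ x ∈ P₁, (rK11_orCherry A x * rK11_orCherry B x) := IsUnitK.sum_mul_nonneg hP hd hcor (rK11_orCherry_isUnitK hA) (rK11_orCherry_isUnitK hB)
  have t14 : 0 ≤ ∑ x ∈ P₁, (rK10_orCherry A x * rK12_orCherry B x) := IsUnitK.sum_mul_nonneg hP hd hcor (rK10_orCherry_isUnitK hA) (rK12_orCherry_isUnitK hB)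
  have t15 : 0 ≤ ∑ x ∈ P₁, (rK12_orCherry A x * rK10_orCherry B x) := IsUnitK.sum_mul_nonneg hP hd hcor (rK12_orCherry_isUnitK hA) (rK10_orCherry_isUnitK hB)
  have t16 : 0 ≤ ∑ x ∈ P₁, (rK12_orCherry A x * rK11_orCherry B x) := IsUnitK.sum_mul_nonneg hP hd hcor (rK12_orCherry_isUnitK hA) (rK11_orCherry_isUnitK hB)
  have t17 : 0 ≤ ∑ x ∈ P₁, (rK11_orCherry A x * rK12_orCherry B x) := IsUnitK.sum_mul_nonneg hP hd hcor (rK11_orCherry_isUnitK hA) (rK12_orCherry_isUnitK hB)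
  have t18 : 0 ≤ ∑ x ∈ P₁, 2 * (rK13_orCherry A x * rK13_orCherry B x) := by rw [← Finset.mul_sum]; exact mul_nonneg (by norm_num) (IsUnitK.sum_mul_nonneg hP hd hcor (rK13_orCherry_isUnitK hA) (rK13_orCherry_isUnitK hB))
  have t19 : 0 ≤ ∑ x ∈ P₁, (rN1_orCherry A x * rN2_orCherry B x) := sum_nonneg fun x _ => mul_nonneg (rN1_orCherry_nonneg hA x) (rN2_orCherry_nonneg hB x)
  have t20 : 0 ≤ ∑ x ∈ P₁, (rN3_orCherry A x * rN2_orCherry B x) := sum_nonneg fun x _ => mul_nonneg (rN3_orCherry_nonneg hA x) (rN2_orCherry_nonneg hB x)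
  have t21 : 0 ≤ ∑ x ∈ P₁, (rN2_orCherry A x * rN1_orCherry B x) := sum_nonneg fun x _ => mul_nonneg (rN2_orCherry_nonneg hA x) (rN1_orCherry_nonneg hB x)
  have t22 : 0 ≤ ∑ x ∈ P₁, (rN2_orCherry A x * rN3_orCherry B x) := sum_nonneg fun x _ => mul_nonneg (rN2_orCherry_nonneg hA x) (rN3_orCherry_nonneg hB x)
  have t23 : 0 ≤ ∑ x ∈ P₁, (rN4_orCherry A x * rN5_orCherry B x) := sum_nonneg fun x _ => mul_nonneg (rN4_orCherry_nonneg hA x) (rN5_orCherry_nonneg hB x)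
  have t24 : 0 ≤ ∑ x ∈ P₁, (rN5_orCherry A x * rN4_orCherry B x) := sum_nonneg fun x _ => mul_nonneg (rN5_orCherry_nonneg hA x) (rN4_orCherry_nonneg hB x)
  have t25 : 0 ≤ ∑ x ∈ P₁, (rN5_orCherry A x * rN6_orCherry B x) := sum_nonneg fun x _ => mul_nonneg (rN5_orCherry_nonneg hA x) (rN6_orCherry_nonneg hB x)
  have t26 : 0 ≤ ∑ x ∈ P₁, (rN6_orCherry A x * rN5_orCherry B x) := sum_nonneg fun x _ => mul_nonneg (rN6_orCherry_nonneg hA x) (rN5_orCherry_nonneg hB x)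
  have t27 : 0 ≤ ∑ x ∈ P₁, 2 * (rN7_orCherry A x * rN8_orCherry B x) := by rw [← Finset.mul_sum]; exact mul_nonneg (by norm_num) (sum_nonneg fun x _ => mul_nonneg (rN7_orCherry_nonneg hA x) (rN8_orCherry_nonneg hB x))
  have t28 : 0 ≤ ∑ x ∈ P₁, 2 * (rN8_orCherry A x * rN7_orCherry B x) := by rw [← Finset.mul_sum]; exact mul_nonneg (by norm_num) (sum_nonneg fun x _ => mul_nonneg (rN8_orCherry_nonneg hA x) (rN7_orCherry_nonneg hB x))
  have t29 : 0 ≤ ∑ x ∈ P₁, (rN9_orCherry A x * rN10_orCherry B x) := sum_nonneg fun x _ => mul_nonneg (rN9_orCherry_nonneg hA x) (rN10_orCherry_nonneg hB x)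
  have t30 : 0 ≤ ∑ x ∈ P₁, (rN11_orCherry A x * rN12_orCherry B x) := sum_nonneg fun x _ => mul_nonneg (rN11_orCherry_nonneg hA x) (rN12_orCherry_nonneg hB x)
  have t31 : 0 ≤ ∑ x ∈ P₁, (rN12_orCherry A x * rN11_orCherry B x) := sum_nonneg fun x _ => mul_nonneg (rN12_orCherry_nonneg hA x) (rN11_orCherry_nonneg hB x)
  have t32 : 0 ≤ ∑ x ∈ P₁, (rN10_orCherry A x * rN9_orCherry B x) := sum_nonneg fun x _ => mul_nonneg (rN10_orCherry_nonneg hA x) (rN9_orCherry_nonneg hB x)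
  have t33 : 0 ≤ ∑ x ∈ P₁, (rN13_orCherry A x * rN14_orCherry B x) := sum_nonneg fun x _ => mul_nonneg (rN13_orCherry_nonneg hA x) (rN14_orCherry_nonneg hB x)
  have t34 : 0 ≤ ∑ x ∈ P₁, (rN15_orCherry A x * rN14_orCherry B x) := sum_nonneg fun x _ => mul_nonneg (rN15_orCherry_nonneg hA x) (rN14_orCherry_nonneg hB x)
  have t35 : 0 ≤ ∑ x ∈ P₁, (rN14_orCherry A x * rN13_orCherry B x) := sum_nonneg fun x _ => mul_nonneg (rN14_orCherry_nonneg hA x) (rN13_orCherry_nonneg hB x)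
  have t36 : 0 ≤ ∑ x ∈ P₁, (rN14_orCherry A x * rN15_orCherry B x) := sum_nonneg fun x _ => mul_nonneg (rN14_orCherry_nonneg hA x) (rN15_orCherry_nonneg hB x)
  have t37 : 0 ≤ ∑ x ∈ P₁, (rN11_orCherry A x * rN11_orCherry B x) := sum_nonneg fun x _ => mul_nonneg (rN11_orCherry_nonneg hA x) (rN11_orCherry_nonneg hB x)
  have t38 : 0 ≤ ∑ x ∈ P₁, (rN10_orCherry A x * rN10_orCherry B x) := sum_nonneg fun x _ => mul_nonneg (rN10_orCherry_nonneg hA x) (rN10_orCherry_nonneg hB x)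
  have t39 : 0 ≤ ∑ x ∈ P₁, (rN1_orCherry A x * rN1_orCherry B x) := sum_nonneg fun x _ => mul_nonneg (rN1_orCherry_nonneg hA x) (rN1_orCherry_nonneg hB x)
  have t40 : 0 ≤ ∑ x ∈ P₁, (rN3_orCherry A x * rN3_orCherry B x) := sum_nonneg fun x _ => mul_nonneg (rN3_orCherry_nonneg hA x) (rN3_orCherry_nonneg hB x)
  have t41 : 0 ≤ ∑ x ∈ P₁, (rN16_orCherry A x * rN17_orCherry B x) := sum_nonneg fun x _ => mul_nonneg (rN16_orCherry_nonneg hA x) (rN17_orCherry_nonneg hB x)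
  have t42 : 0 ≤ ∑ x ∈ P₁, (rN17_orCherry A x * rN16_orCherry B x) := sum_nonneg fun x _ => mul_nonneg (rN17_orCherry_nonneg hA x) (rN16_orCherry_nonneg hB x)
  have t43 : 0 ≤ ∑ x ∈ P₁, (rN18_orCherry A x * rN19_orCherry B x) := sum_nonneg fun x _ => mul_nonneg (rN18_orCherry_nonneg hA x) (rN19_orCherry_nonneg hB x)
  have t44 : 0 ≤ ∑ x ∈ P₁, (rN19_orCherry A x * rN18_orCherry B x) := sum_nonneg fun x _ => mul_nonneg (rN19_orCherry_nonneg hA x) (rN18_orCherry_nonneg hB x)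
  have t45 : 0 ≤ ∑ x ∈ P₁, (rN18_orCherry A x * rN20_orCherry B x) := sum_nonneg fun x _ => mul_nonneg (rN18_orCherry_nonneg hA x) (rN20_orCherry_nonneg hB x)
  have t46 : 0 ≤ ∑ x ∈ P₁, (rN21_orCherry A x * rN16_orCherry B x) := sum_nonneg fun x _ => mul_nonneg (rN21_orCherry_nonneg hA x) (rN16_orCherry_nonneg hB x)
  have t47 : 0 ≤ ∑ x ∈ P₁, (rN16_orCherry A x * rN21_orCherry B x) := sum_nonneg fun x _ => mul_nonneg (rN16_orCherry_nonneg hA x) (rN21_orCherry_nonneg hB x)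
  have t48 : 0 ≤ ∑ x ∈ P₁, (rN20_orCherry A x * rN18_orCherry B x) := sum_nonneg fun x _ => mul_nonneg (rN20_orCherry_nonneg hA x) (rN18_orCherry_nonneg hB x)
  have t49 : 0 ≤ ∑ x ∈ P₁, (rN22_orCherry A x * rN6_orCherry B x) := sum_nonneg fun x _ => mul_nonneg (rN22_orCherry_nonneg hA x) (rN6_orCherry_nonneg hB x)
  have t50 : 0 ≤ ∑ x ∈ P₁, (rN6_orCherry A x * rN22_orCherry B x) := sum_nonneg fun x _ => mul_nonneg (rN6_orCherry_nonneg hA x) (rN22_orCherry_nonneg hB x)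
  have t51 : 0 ≤ ∑ x ∈ P₁, (rN23_orCherry A x * rN4_orCherry B x) := sum_nonneg fun x _ => mul_nonneg (rN23_orCherry_nonneg hA x) (rN4_orCherry_nonneg hB x)
  have t52 : 0 ≤ ∑ x ∈ P₁, (rN4_orCherry A x * rN23_orCherry B x) := sum_nonneg fun x _ => mul_nonneg (rN4_orCherry_nonneg hA x) (rN23_orCherry_nonneg hB x)
  have t53 : 0 ≤ ∑ x ∈ P₁, (rN23_orCherry A x * rN24_orCherry B x) := sum_nonneg fun x _ => mul_nonneg (rN23_orCherry_nonneg hA x) (rN24_orCherry_nonneg hB x)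
  have t54 : 0 ≤ ∑ x ∈ P₁, (rN24_orCherry A x * rN22_orCherry B x) := sum_nonneg fun x _ => mul_nonneg (rN24_orCherry_nonneg hA x) (rN22_orCherry_nonneg hB x)
  have t55 : 0 ≤ ∑ x ∈ P₁, (rN24_orCherry A x * rN23_orCherry B x) := sum_nonneg fun x _ => mul_nonneg (rN24_orCherry_nonneg hA x) (rN23_orCherry_nonneg hB x)
  have t56 : 0 ≤ ∑ x ∈ P₁, (rN22_orCherry A x * rN24_orCherry B x) := sum_nonneg fun x _ => mul_nonneg (rN22_orCherry_nonneg hA x) (rN24_orCherry_nonneg hB x)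
  have t57 : 0 ≤ ∑ x ∈ P₁, (rN25_orCherry A x * rN17_orCherry B x) := sum_nonneg fun x _ => mul_nonneg (rN25_orCherry_nonneg hA x) (rN17_orCherry_nonneg hB x)
  have t58 : 0 ≤ ∑ x ∈ P₁, (rN26_orCherry A x * rN19_orCherry B x) := sum_nonneg fun x _ => mul_nonneg (rN26_orCherry_nonneg hA x) (rN19_orCherry_nonneg hB x)
  have t59 : 0 ≤ ∑ x ∈ P₁, (rN19_orCherry A x * rN26_orCherry B x) := sum_nonneg fun x _ => mul_nonneg (rN19_orCherry_nonneg hA x) (rN26_orCherry_nonneg hB x)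
  have t60 : 0 ≤ ∑ x ∈ P₁, (rN17_orCherry A x * rN25_orCherry B x) := sum_nonneg fun x _ => mul_nonneg (rN17_orCherry_nonneg hA x) (rN25_orCherry_nonneg hB x)
  have t61 : 0 ≤ ∑ x ∈ P₁, (rN27_orCherry A x * rN20_orCherry B x) := sum_nonneg fun x _ => mul_nonneg (rN27_orCherry_nonneg hA x) (rN20_orCherry_nonneg hB x)
  have t62 : 0 ≤ ∑ x ∈ P₁, (rN20_orCherry A x * rN27_orCherry B x) := sum_nonneg fun x _ => mul_nonneg (rN20_orCherry_nonneg hA x) (rN27_orCherry_nonneg hB x)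
  have t63 : 0 ≤ ∑ x ∈ P₁, (rN28_orCherry A x * rN21_orCherry B x) := sum_nonneg fun x _ => mul_nonneg (rN28_orCherry_nonneg hA x) (rN21_orCherry_nonneg hB x)
  have t64 : 0 ≤ ∑ x ∈ P₁, (rN21_orCherry A x * rN28_orCherry B x) := sum_nonneg fun x _ => mul_nonneg (rN21_orCherry_nonneg hA x) (rN28_orCherry_nonneg hB x)
  have t65 : 0 ≤ ∑ x ∈ P₁, (rN26_orCherry A x * rN26_orCherry B x) := sum_nonneg fun x _ => mul_nonneg (rN26_orCherry_nonneg hA x) (rN26_orCherry_nonneg hB x)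
  have t66 : 0 ≤ ∑ x ∈ P₁, (rN25_orCherry A x * rN25_orCherry B x) := sum_nonneg fun x _ => mul_nonneg (rN25_orCherry_nonneg hA x) (rN25_orCherry_nonneg hB x)
  have t67 : 0 ≤ ∑ x ∈ P₁, rs1_orCherry A B x := sum_nonneg fun x _ => rs1_orCherry_nonneg hA hB x
  have t68 : 0 ≤ ∑ x ∈ P₁, rs2_orCherry A B x := sum_nonneg fun x _ => rs2_orCherry_nonneg hA hB x
  linarith [t1, t2, t3, t4, t5, t6, t7, t8, t9, t10, t11, t12, t13, t14, t15, t16, t17, t18, t19, t20, t21, t22, t23, t24, t25, t26, t27, t28, t29, t30, t31, t32, t33, t34, t35, t36, t37, t38, t39, t40, t41, t42, t43, t44, t45, t46, t47, t48, t49, t50, t51, t52, t53, t54, t55, t56, t57, t58, t59, t60, t61, t62, t63, t64, t65, t66, t67, t68]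

/-- The sectionwise Formula-A score is a score certificate for `P₁ ∧ orCherry`. [this work] -/
theorem scoreCert_andProd_orCherry : ScoreCert (andProd P₁ orCherry) (secFAScore P₁ orCherry) := fun _ _ hA hB =>
  ⟨lForm_le_scoreVal_andProd_orCherry hP hd hcor hA hB, scoreVal_secFAScore_le_uForm hP isUpperSet_orCherry hA hB⟩

/-- **`TriWIneq` for `P₁ ∧ orCherry`** on every index cube, for every intersecting Kleitman shell `P₁`. [this work] -/
theorem triW_nonneg_andProd_orCherry (F G : Finset β → Finset (Finset (γ₁ ⊕ Fin 4)))
    (hF : ∀ x, IsUpperSet (F x : Set (Finset (γ₁ ⊕ Fin 4)))) (hG : ∀ x, IsUpperSet (G x : Set (Finset (γ₁ ⊕ Fin 4))))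
    (hFm : Monotone F) (hGm : Monotone G) : 0 ≤ triW (andProd P₁ orCherry) F G :=
  triW_nonneg_of_scoreCert (monoScore_secFAScore P₁ orCherry) (scoreCert_andProd_orCherry hP hd hcor) F G hF hG hFm hGm

end main

/-- The same with the hypothesis on `P₁` in Kleitman-shell form. [this work] -/
theorem triW_nonneg_andProd_orCherry_of_klShell {P₁ : Finset (Finset γ₁)} (hP : IsUpperSet (P₁ : Set (Finset γ₁)))
    (hd : Disjoint P₁ (refl P₁)) (hs : KlShell (P₁ ∪ refl P₁)) (F G : Finset β → Finset (Finset (γ₁ ⊕ Fin 4)))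
    (hF : ∀ x, IsUpperSet (F x : Set (Finset (γ₁ ⊕ Fin 4)))) (hG : ∀ x, IsUpperSet (G x : Set (Finset (γ₁ ⊕ Fin 4))))
    (hFm : Monotone F) (hGm : Monotone G) : 0 ≤ triW (andProd P₁ orCherry) F G :=
  triW_nonneg_andProd_orCherry hP hd (fun U V hU hV => by rw [corP_eq_card_sub_card_of_disjoint hd]; exact hs U V hU hV) F G hF hG hFm hGm

end FiveUpSet

end Summit.CriticalPhenomena.PercolationContinuityZ3.Theorems
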